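import Summits.SmoothPoincare4.SmoothPoincare4.Theorems.ConvexBisectionAcyclicBisectionExistsBeltLongitudeModel
import Literature.Geometry.Symplectic.LegendrianRealisationProofs
import HarnessLib

/-!
# Isotopies of framed knots in the boundary: push-forward by a diffeomorphism and change of endpoints
(node T3c-1 `node_belt_isotopic_pushoff` of the sub-goal T3 of stub `stub_steinRealisation` (NF6), line
`modp-braid-orbits`, crux `ConvexBisection.AcyclicBisectionExists`, item stmt-SmoothPoincare4-10508;
wave 3, worker Z5, lead c5; plumbing for stage (3c) of V6-REPORT §2)

Plumbing for the tube comparison (`…BeltTubeComparison.lean`), where the framed `r`-longitude is moved by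
ONE diffeomorphism `F` of `W` (the end of the reflecting diffeotopy of `∂W`, spread over a collar):

* §1 `isotopyPostcomp Φ F` — the isotopy `t ↦ F ∘ Φ(t)` of knots in `∂W`
  (diffeomorphisms preserve embeddings and the boundary), and **`isFramingAlong_postcomp`** — a framing
  family carried along `Φ` is pushed by `dF` to a framing family carried along `F ∘ Φ`
  (`IsKnotFraming.pushforward` stagewise; joint continuity through the tangent map of `F`);
* §2 `isotopyCast` / `isFramingAlong_cast` — the same isotopy between propositionally
  equal endpoints / from a propositionally equal initial framing (for concatenation with
  `KnotIsotopyInBoundary.trans'`, whose junction data must agree on the nose);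
* §3 registered helper `helper_belt_isotopyPush`.

Everything is proved; no named facts.

## References
* A. A. Kosinski, *Differential Manifolds*, Academic Press (1993), III (2.7)–(2.8), VIII proof of (1.2).
  [Kosinski1993]
-/

noncomputable section

-- the prescribed namespace `Summit.<P>.<Sub>.…` duplicates `SmoothPoincare4` (P = Sub)
set_option linter.dupNamespace false

open scoped Manifold ContDiff Topology
open Set Function Metric Bundle

namespace Summit.SmoothPoincare4.SmoothPoincare4.Theorems.AcyclicBisectionExists.ModpBraidOrbits

open Literature.Topology.FourManifolds Literature.Geometry.Symplectic

variable {W : Type*} [TopologicalSpace W] [ChartedSpace (EuclideanHalfSpace 4) W] [IsManifold (𝓡∂ 4) ∞ W]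
  {K K' L L' : sphere (0 : EuclideanSpace ℝ (Fin 2)) 1 → W}

/-! ### §1 Push-forward of an isotopy of knots in `∂W` and of a framing family by a diffeomorphism -/

/-- **The push-forward `t ↦ F ∘ Φ(t)` of an isotopy of knots in `∂W` by a diffeomorphism `F` of `W`.**
[cite: Kosinski1993, VIII proof of (1.2)] -/
def isotopyPostcomp (Φ : KnotIsotopyInBoundary K K')
    (F : W ≃ₘ⟮𝓡∂ 4, 𝓡∂ 4⟯ W) : KnotIsotopyInBoundary (F ∘ K) (F ∘ K') where
  toFun t := F ∘ Φ.toFun t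
  contMDiff := F.contMDiff.comp Φ.contMDiff
  isSmoothEmbedding t := (Φ.isSmoothEmbedding t).diffeomorph_comp F
  map_zero := by
    show F ∘ Φ.toFun 0 = F ∘ K
    rw [Φ.map_zero]
  map_one := by
    show F ∘ Φ.toFun 1 = F ∘ K'
    rw [Φ.map_one]
  isBoundaryPoint t ht u := ((Φ.isBoundaryKnot ht).comp_diffeomorph F).isBoundaryPoint u

/-- Stages of the push-forward. [folklore] -/
@[simp] theorem isotopyPostcomp_toFun
    (Φ : KnotIsotopyInBoundary K K') (F : W ≃ₘ⟮𝓡∂ 4, 𝓡∂ 4⟯ W) (t : ℝ) :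
    (isotopyPostcomp Φ F).toFun t = F ∘ Φ.toFun t := rfl

/-- **A framing family carried along `Φ` is pushed by `dF` to a framing family carried along `F ∘ Φ`.**
[cite: Kosinski1993, III (2.7)–(2.8)] -/
theorem isFramingAlong_postcomp {Φ : KnotIsotopyInBoundary K K'}
    {ν : sphere (0 : EuclideanSpace ℝ (Fin 2)) 1 → EuclideanSpace ℝ (Fin 4)}
    {νt : ℝ → sphere (0 : EuclideanSpace ℝ (Fin 2)) 1 → EuclideanSpace ℝ (Fin 4)}
    (h : IsFramingAlong Φ ν νt) (F : W ≃ₘ⟮𝓡∂ 4, 𝓡∂ 4⟯ W) :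
    IsFramingAlong (isotopyPostcomp Φ F) (fun u => mfderiv (𝓡∂ 4) (𝓡∂ 4) F (K u) (ν u))
      fun t u => mfderiv (𝓡∂ 4) (𝓡∂ 4) F (Φ.toFun t u) (νt t u) where
  apply_zero := by
    have key : ∀ (G : sphere (0 : EuclideanSpace ℝ (Fin 2)) 1 → W) (_ : G = K)
        (μ : sphere (0 : EuclideanSpace ℝ (Fin 2)) 1 → EuclideanSpace ℝ (Fin 4)) (_ : μ = ν),
        (fun u => mfderiv (𝓡∂ 4) (𝓡∂ 4) F (G u) (μ u)) = fun u => mfderiv (𝓡∂ 4) (𝓡∂ 4) F (K u) (ν u) := by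
      intro G e μ eμ; subst e; subst eμ; rfl
    exact key _ Φ.map_zero _ h.apply_zero
  isKnotFraming t ht := (h.isKnotFraming t ht).pushforward (Φ.isBoundaryKnot ht) F
  continuousOn := by
    have hF : Continuous (tangentMap (𝓡∂ 4) (𝓡∂ 4) F) := F.contMDiff.continuous_tangentMap (by simp)
    exact (hF.comp_continuousOn h.continuousOn).congr fun p _ => rfl

/-! ### §2 Changing endpoints and initial framing along propositional equalities -/

omit [IsManifold (𝓡∂ 4) ∞ W] in
/-- **The same isotopy between propositionally equal endpoints.** [folklore] -/
def isotopyCast (Φ : KnotIsotopyInBoundary K K')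
    (e : K = L) (e' : K' = L') : KnotIsotopyInBoundary L L' where
  toFun := Φ.toFun
  contMDiff := Φ.contMDiff
  isSmoothEmbedding := Φ.isSmoothEmbedding
  map_zero := Φ.map_zero.trans e
  map_one := Φ.map_one.trans e'
  isBoundaryPoint := Φ.isBoundaryPoint

omit [IsManifold (𝓡∂ 4) ∞ W] in
/-- Stages are unchanged by `isotopyCast`. [folklore] -/
@[simp] theorem isotopyCast_toFun
    (Φ : KnotIsotopyInBoundary K K') (e : K = L) (e' : K' = L') (t : ℝ) :
    (isotopyCast Φ e e').toFun t = Φ.toFun t := rfl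

/-- **The same framing family along the cast isotopy, from a propositionally equal initial framing.**
[folklore] -/
theorem isFramingAlong_cast {Φ : KnotIsotopyInBoundary K K'}
    {ν μ : sphere (0 : EuclideanSpace ℝ (Fin 2)) 1 → EuclideanSpace ℝ (Fin 4)}
    {νt : ℝ → sphere (0 : EuclideanSpace ℝ (Fin 2)) 1 → EuclideanSpace ℝ (Fin 4)}
    (h : IsFramingAlong Φ ν νt) (e : K = L) (e' : K' = L') (eν : ν = μ) :
    IsFramingAlong (isotopyCast Φ e e') μ νt where
  apply_zero := h.apply_zero.trans eν
  isKnotFraming := h.isKnotFraming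
  continuousOn := h.continuousOn

/-! ### §3 Registered helper -/

/-- **Registered helper `helper_belt_isotopyPush` (node T3c-1 of NF6 `stub_steinRealisation`, plumbing for
stage (3c), wave 3, lead c5): an isotopy of knots in `∂W` with a framing family carried along it is
pushed by a diffeomorphism `F` of `W` to an isotopy of knots in `∂W` — stages `F ∘ Φ(t)` — carrying the
framings `dF (νt)`.** [cite: Kosinski1993, III (2.7)–(2.8)] -/
theorem helper_belt_isotopyPush :
    ∀ {W : Type} [TopologicalSpace W] [ChartedSpace (EuclideanHalfSpace 4) W] [IsManifold (𝓡∂ 4) ∞ W]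
      {K K' : Metric.sphere (0 : EuclideanSpace ℝ (Fin 2)) 1 → W}
      (Φ : Literature.Geometry.Symplectic.KnotIsotopyInBoundary K K')
      (ν : Metric.sphere (0 : EuclideanSpace ℝ (Fin 2)) 1 → EuclideanSpace ℝ (Fin 4))
      (νt : ℝ → Metric.sphere (0 : EuclideanSpace ℝ (Fin 2)) 1 → EuclideanSpace ℝ (Fin 4))
      (F : W ≃ₘ⟮𝓡∂ 4, 𝓡∂ 4⟯ W),
      Literature.Geometry.Symplectic.IsFramingAlong Φ ν νt →
      ∃ Ψ : Literature.Geometry.Symplectic.KnotIsotopyInBoundary (F ∘ K) (F ∘ K'),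
        (∀ t, Ψ.toFun t = F ∘ Φ.toFun t) ∧
        Literature.Geometry.Symplectic.IsFramingAlong Ψ (fun u => mfderiv (𝓡∂ 4) (𝓡∂ 4) F (K u) (ν u))
          fun t u => mfderiv (𝓡∂ 4) (𝓡∂ 4) F (Φ.toFun t u) (νt t u) := by
  intro W _ _ _ K K' Φ ν νt F h
  exact ⟨isotopyPostcomp Φ F, fun t => rfl, isFramingAlong_postcomp h F⟩

end Summit.SmoothPoincare4.SmoothPoincare4.Theorems.AcyclicBisectionExists.ModpBraidOrbits

end
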